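import Summits.RiemannHypothesis.RiemannHypothesis.Theorems.GroundBartaEvenWinsBeyondArchPhantomCertificate
import Literature.NumberTheory.LFunctions.WeilTwoPrimeCellsT120NuSplit
import HarnessLib

/-!
# RiemannHypothesis / GroundBarta — rung 4 (`EvenWinsBeyondArch`, stmt-RiemannHypothesis-18807 / 18085):
# the moment check of a phantom certificate `WeilCert23X` on the landed `[0, 120]` chain from per-chunk kernel facts

Helper file (`--supports stmt-RiemannHypothesis-18085`), RH-free.  Prover A g12 (unit `sr-gb-rung-a`), after
`WeilCert23.checkNuAt_of_partsT120` (Literature) and `tl_checkNuAt_of_partsT224_level` (A g11).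

For a phantom-ripple certificate (`WeilCert23X`, seat rh-explicit-weil-1) whose two-prime cells are the landed chain
`weilTwoPrimeCellsT120` at the low level `weilTwoPrimeCellsT120Level` with `T = 120`, the claimed scaled moment `ν_q` is checked from
the six landed chunk facts `cellsMomentQ₂₃ wL₁₂₀ (chunk i) q = vᵢ` (`nuPartT120_i_q_eq`), ONE kernel fact `xCellsMomentQ c.xcells q = v_X`
on the phantom chain, the level-shift term `(wL − wL₁₂₀)·120^{q+1}/(q+1)` (`momentX`) and one literal inequality (`decide`):
`x_checkNuAt_of_partsT120`.  No new moment data for the `ψ`-chain is needed by any phantom certificate on `[0, 120]`.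
-/

set_option linter.dupNamespace false

noncomputable section

namespace Summit.RiemannHypothesis.RiemannHypothesis.Theorems.EvenWinsBeyondArch

open Literature.NumberTheory.LFunctions

/-- **Moment check of a phantom certificate on the `[0,120]` chain from parts**: with the six chunk values `vᵢ` of the landed
facts, the phantom-chain moment `v_X`, and the literal check
`|ν_q − nuScale·a₀^q·2(v₀+⋯+v₅ + (wL − wL₁₂₀)·120^{q+1}/(q+1) − v_X)| ≤ 2^{-pnu}`, entry `q` of the table is correct. [folklore] -/
theorem x_checkNuAt_of_partsT120 (c : WeilCert23X) (hcells : c.cells = weilTwoPrimeCellsT120)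
    (hwl0 : c.base.wL = weilTwoPrimeCellsT120Level) (hT : c.base.T = 120) {wL' : ℚ} (hwL : c.wL = wL') (q : ℕ)
    {v₀ v₁ v₂ v₃ v₄ v₅ vX : ℚ}
    (h₀ : cellsMomentQ₂₃ weilTwoPrimeCellsT120Level weilTwoPrimeCellsT120C0 q = v₀)
    (h₁ : cellsMomentQ₂₃ weilTwoPrimeCellsT120Level weilTwoPrimeCellsT120C1 q = v₁)
    (h₂ : cellsMomentQ₂₃ weilTwoPrimeCellsT120Level weilTwoPrimeCellsT120C2 q = v₂)
    (h₃ : cellsMomentQ₂₃ weilTwoPrimeCellsT120Level weilTwoPrimeCellsT120C3 q = v₃)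
    (h₄ : cellsMomentQ₂₃ weilTwoPrimeCellsT120Level weilTwoPrimeCellsT120C4 q = v₄)
    (h₅ : cellsMomentQ₂₃ weilTwoPrimeCellsT120Level weilTwoPrimeCellsT120C5 q = v₅)
    (hX : xCellsMomentQ c.xcells q = vX)
    (hlit : |getV c.nuData q - nuScale * (c.base.a0 ^ q *
      (2 * (v₀ + v₁ + v₂ + v₃ + v₄ + v₅ + (wL' - weilTwoPrimeCellsT120Level) * ((120 : ℚ) ^ (q + 1) / ((q : ℚ) + 1)) - vX)))| ≤
      1 / 2 ^ c.pnu) :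
    c.checkNuAt q = true := by
  unfold WeilCert23X.checkNuAt WeilCert23X.nuQ momentX
  rw [decide_eq_true_eq, hcells, hwl0, hT, hwL, cellsMomentQ₂₃_T120_split, h₀, h₁, h₂, h₃, h₄, h₅, hX]
  exact hlit

/-- The same with the chunk sum named: `Σᵢ vᵢ = V`. [folklore] -/
theorem x_checkNuAt_of_sumT120 (c : WeilCert23X) (hcells : c.cells = weilTwoPrimeCellsT120)
    (hwl0 : c.base.wL = weilTwoPrimeCellsT120Level) (hT : c.base.T = 120) {wL' : ℚ} (hwL : c.wL = wL') (q : ℕ) {V vX : ℚ}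
    (hV : cellsMomentQ₂₃ weilTwoPrimeCellsT120Level weilTwoPrimeCellsT120 q = V) (hX : xCellsMomentQ c.xcells q = vX)
    (hlit : |getV c.nuData q - nuScale * (c.base.a0 ^ q *
      (2 * (V + (wL' - weilTwoPrimeCellsT120Level) * ((120 : ℚ) ^ (q + 1) / ((q : ℚ) + 1)) - vX)))| ≤ 1 / 2 ^ c.pnu) :
    c.checkNuAt q = true := by
  unfold WeilCert23X.checkNuAt WeilCert23X.nuQ momentX
  rw [decide_eq_true_eq, hcells, hwl0, hT, hwL, hV, hX]
  exact hlit

end Summit.RiemannHypothesis.RiemannHypothesis.Theorems.EvenWinsBeyondArch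

end
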